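/-
Lane (xiv-h) «MASS-AWARE CEILING» part 1/5 — MECHANICAL CARVE (rh-split-typer-3 g2, RULING #292 (c)) of zd-neg GEN-18
`HOME/rh-split-zd-neg/g18/tree/MassAwareSamplingCeiling.lean` sha16 60d461fef9600800 (1191 l): source lines 52–406 VERBATIM
(cut at the source's `###` section-doc seams); only this header, the imports, the namespace brackets and 3 insert-only one-line docstring(s) (gate `lint.docstring`, repair xivh-a) are added per part.
Nothing here bears on the truth of RH.
-/
import Mathlib
import Summits.RiemannHypothesis.RiemannHypothesis.Theorems.Splittings.BombieriTruncMassSampling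

/-!
# Splittings — zd-neg GEN-18 «MASS-AWARE CEILING» (the node `MassAwareSamplingL L 2 θ` is FALSE for every `θ ≥ 2/5`), part 1/5
(source sections G18.0 / G15.0b / G18.1 (to before G15.5)): the capped / all-windows family `LocBandL`, `MassAwareSamplingL`, `LocBandAll`, `MassAwareSamplingAllCap` (x-wuc G9b verbatim) and the generic G15 lemmas (lattice, synthesis, gain, visibility `mvis`).
Full provenance, audit notes and the section map are in the source header (zd-neg g18, card `cards/SPLIT-zd-neg.md` GEN-18).

HONEST LABEL: «SPLITTING SEARCH over kernel-typed RH-EQUIVALENCES; a splitting A ∧ B ⟹ RH is CONDITIONAL bookkeeping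
unless A and B are both proved; nothing here bears on the truth of RH.»
-/

set_option linter.dupNamespace false

noncomputable section

open scoped Classical ComplexConjugate
open Set Filter Topology Complex MeasureTheory

namespace Summit.RiemannHypothesis.RiemannHypothesis.Theorems.Splittings.MassAwareSamplingCeiling

open Summit.RiemannHypothesis.RiemannHypothesis.Theorems.Splittings.BombieriTruncMassAware (Phi LocBand MassAwareSampling)

/-! ### G18.0 The audited definitions `Phi`, `LocBand`, `MassAwareSampling` are the TREE's (`BombieriTruncMassSampling.lean` ll. 55 / 60 / 74,
namespace `…BombieriTruncMassAware`, opened above); nothing is restated. -/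

/-! ### G15.0b The CAPPED / ALL-WINDOWS FAMILY of x-wuc G9b — VERBATIM copies of `LocBandL`, `MassAwareSamplingL`, `LocBandAll`,
`MassAwareSamplingAllCap` (`HOME/rh-split-x-wuc/SplitXWucG9b.lean` 55abd30229cdb674, ll. 1556 / 1573 / 2110 / 2124; not in the tree at the
time of writing).  `MassAwareSampling = MassAwareSamplingL 4` definitionally (`massAwareSampling_iff_massAwareSamplingL_four`, copied too). -/

/-- [x-wuc G9b l.1556, verbatim] LOCAL BAND with WINDOW CAP `L`. -/
def LocBandL (L δ D Λ : ℝ) {n : ℕ} (lam w : Fin n → ℝ) (w₀ : ℝ) : Prop :=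
  ∀ a b : ℝ, -Λ ≤ a → a < b → b ≤ Λ → b - a ≤ L →
    |(∑ k ∈ Finset.univ.filter (fun k ↦ a < lam k ∧ lam k ≤ b), w k) +
        (if a < 0 ∧ 0 ≤ b then w₀ else 0) - D * (b - a)| ≤ δ * D

/-- [x-wuc G9b l.1573, verbatim] MASS-AWARE SAMPLING with WINDOW CAP `L`. -/
def MassAwareSamplingL (L δ θ : ℝ) : Prop :=
  ∀ ε : ℝ, 0 < ε → ∀ κ₀ : ℝ, 0 < κ₀ → κ₀ < 1 / 2 → ∀ D : ℝ, 1 ≤ D →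
    ∃ Λ : ℝ, 0 < Λ ∧ Λ ≤ Real.exp (2 * Real.pi * D) / 4 ∧
      ∀ (n : ℕ) (lam w κ : Fin n → ℝ) (w₀ : ℝ), 0 ≤ w₀ → w₀ ≤ δ * D →
        (∀ k, 0 < w k) → (∀ k, 0 ≤ κ k ∧ κ k < 1 / 2) → LocBandL L δ D Λ lam w w₀ →
        ∃ b : Fin n → ℂ,
          (∫ u in Icc (-1 : ℝ) 1, ‖2 * (Real.sinh (κ₀ * u) : ℂ) -
              ∑ k, b k * (Real.cosh (κ k * u) : ℂ) * cexp (-(I * (lam k : ℂ) * u))‖ ^ 2) +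
            ∑ k, ‖b k‖ ^ 2 / w k ≤ (1 + ε) * Phi κ₀ / (2 * Real.pi * θ * D)

/-- [x-wuc G9b l.1583, verbatim] `MassAwareSampling δ θ ↔ MassAwareSamplingL 4 δ θ`, definitionally. -/
theorem massAwareSampling_iff_massAwareSamplingL_four {δ θ : ℝ} :
    MassAwareSampling δ θ ↔ MassAwareSamplingL 4 δ θ := Iff.rfl

/-- [x-wuc G9b l.2110, verbatim] LOCAL BAND on ALL windows of `[−Λ, Λ]`. -/
def LocBandAll (δ D Λ : ℝ) {n : ℕ} (lam w : Fin n → ℝ) (w₀ : ℝ) : Prop :=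
  ∀ a b : ℝ, -Λ ≤ a → a < b → b ≤ Λ →
    |(∑ k ∈ Finset.univ.filter (fun k ↦ a < lam k ∧ lam k ≤ b), w k) +
        (if a < 0 ∧ 0 ≤ b then w₀ else 0) - D * (b - a)| ≤ δ * D

/-- [x-wuc G9b l.2124, verbatim] MASS-AWARE SAMPLING, ALL-WINDOWS form with SPECTRAL CAP `Λ₀`. -/
def MassAwareSamplingAllCap (Λ₀ δ θ : ℝ) : Prop :=
  ∀ ε : ℝ, 0 < ε → ∀ κ₀ : ℝ, 0 < κ₀ → κ₀ < 1 / 2 → ∀ D : ℝ, 1 ≤ D →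
    ∃ Λ : ℝ, 0 < Λ ∧ Λ ≤ Λ₀ ∧
      ∀ (n : ℕ) (lam w κ : Fin n → ℝ) (w₀ : ℝ), 0 ≤ w₀ → w₀ ≤ δ * D →
        (∀ k, 0 < w k) → (∀ k, 0 ≤ κ k ∧ κ k < 1 / 2) → LocBandAll δ D Λ lam w w₀ →
        ∃ b : Fin n → ℂ,
          (∫ u in Icc (-1 : ℝ) 1, ‖2 * (Real.sinh (κ₀ * u) : ℂ) -
              ∑ k, b k * (Real.cosh (κ k * u) : ℂ) * cexp (-(I * (lam k : ℂ) * u))‖ ^ 2) +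
            ∑ k, ‖b k‖ ^ 2 / w k ≤ (1 + ε) * Phi κ₀ / (2 * Real.pi * θ * D)


/-- [x-wuc G9b, verbatim] antitone in the cap. -/
theorem locBandL_anti {L L' δ D Λ : ℝ} (hL : L ≤ L') {n : ℕ} {lam w : Fin n → ℝ} {w₀ : ℝ}
    (h : LocBandL L' δ D Λ lam w w₀) : LocBandL L δ D Λ lam w w₀ :=
  fun a b ha hab hb hlen ↦ h a b ha hab hb (hlen.trans hL)

/-- [x-wuc G9b, verbatim] MONOTONICITY IN THE CAP. -/
theorem massAwareSamplingL_mono {L L' δ θ : ℝ} (hL : L ≤ L') (h : MassAwareSamplingL L δ θ) :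
    MassAwareSamplingL L' δ θ := by
  intro ε hε κ₀ hκ₀ hκ₀' D hD
  obtain ⟨Λ, hΛ, hΛcap, hsyn⟩ := h ε hε κ₀ hκ₀ hκ₀' D hD
  exact ⟨Λ, hΛ, hΛcap, fun n lam w κ w₀ hw₀ hw₀' hw hκ hband ↦
    hsyn n lam w κ w₀ hw₀ hw₀' hw hκ (locBandL_anti hL hband)⟩

/-- [x-wuc G9b, verbatim] the cap-4 statement implies every `L`-capped one with `L ≥ 4`. -/
theorem massAwareSamplingL_of_massAwareSampling {L δ θ : ℝ} (hL : 4 ≤ L) (h : MassAwareSampling δ θ) :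
    MassAwareSamplingL L δ θ :=
  massAwareSamplingL_mono hL (massAwareSampling_iff_massAwareSamplingL_four.1 h)

/-- NEW (G18): the capped family is ANTITONE IN THE DISPLACEMENT — a wider band admits more configurations (and a heavier virtual atom),
so `MassAwareSamplingL L δ' θ → MassAwareSamplingL L δ θ` for `δ ≤ δ'`.  Hence a refutation at `δ = 2` refutes every `δ ≥ 2`. -/
theorem massAwareSamplingL_anti_delta {L δ δ' θ : ℝ} (hδ : δ ≤ δ') (h : MassAwareSamplingL L δ' θ) :
    MassAwareSamplingL L δ θ := by
  intro ε hε κ₀ hκ₀ hκ₀' D hD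
  obtain ⟨Λ, hΛ, hΛcap, hsyn⟩ := h ε hε κ₀ hκ₀ hκ₀' D hD
  refine ⟨Λ, hΛ, hΛcap, fun n lam w κ w₀ hw₀ hw₀' hw hκ hband ↦ hsyn n lam w κ w₀ hw₀ ?_ hw hκ ?_⟩
  · exact hw₀'.trans (mul_le_mul_of_nonneg_right hδ (by linarith))
  · exact fun a b ha hab hb hlen ↦ (hband a b ha hab hb hlen).trans (mul_le_mul_of_nonneg_right hδ (by linarith))

/-- Same for the all-windows / spectral-cap form. -/
theorem massAwareSamplingAllCap_anti_delta {Λ₀ δ δ' θ : ℝ} (hδ : δ ≤ δ') (h : MassAwareSamplingAllCap Λ₀ δ' θ) :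
    MassAwareSamplingAllCap Λ₀ δ θ := by
  intro ε hε κ₀ hκ₀ hκ₀' D hD
  obtain ⟨Λ, hΛ, hΛcap, hsyn⟩ := h ε hε κ₀ hκ₀ hκ₀' D hD
  refine ⟨Λ, hΛ, hΛcap, fun n lam w κ w₀ hw₀ hw₀' hw hκ hband ↦ hsyn n lam w κ w₀ hw₀ ?_ hw hκ ?_⟩
  · exact hw₀'.trans (mul_le_mul_of_nonneg_right hδ (by linarith))
  · exact fun a b ha hab hb ↦ (hband a b ha hab hb).trans (mul_le_mul_of_nonneg_right hδ (by linarith))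

/-! ### G18.1 Generic lemmas carried over VERBATIM from zd-neg G15 (`SketchG15.lean` a78db0806f8fec58, G15.1 / G15.3 / G15.4 / G15.5):
`two_mul_re_sub_sq_le`, `latt`, `card_latt_window`, `synth`, `trig`, `re_synth`, `gain`, `gain_ge`, `sum_ite_const_eq`, `mvis`,
`integral_trig_shift_sub`, **`certificate`**, `mvis_eq` -/

/-- `2t·re z − t² ≤ ‖z‖²`. (G14) -/
theorem two_mul_re_sub_sq_le (z : ℂ) (t : ℝ) : 2 * t * z.re - t ^ 2 ≤ ‖z‖ ^ 2 := by
  have h1 : |z.re| ≤ ‖z‖ := Complex.abs_re_le_norm z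
  have h2 : z.re ^ 2 ≤ ‖z‖ ^ 2 := by
    rw [← sq_abs z.re]
    exact pow_le_pow_left₀ (abs_nonneg _) h1 2
  nlinarith [sq_nonneg (z.re - t)]

/-- The lattice `p·j`, `j = k − m ∈ [−m, m]`, indexed by `k : Fin (2m+1)`. (G14) -/
def latt (p : ℝ) (m : ℕ) (k : Fin (2 * m + 1)) : ℝ := p * ((((k : ℕ) : ℤ) - (m : ℤ) : ℤ) : ℝ)

/-- Exact window count of the lattice (G14, floor generalised): for `(a, b] ⊆ [−Λ, Λ]` and `Λ/p < m + 1` the points `p·j`, `|j| ≤ m`, in the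
window number `⌊b/p⌋ − ⌊a/p⌋`. -/
theorem card_latt_window {p Λ a b : ℝ} {m : ℕ} (hp : 0 < p) (hΛp : Λ / p < (m : ℝ) + 1) (ha : -Λ ≤ a) (hab : a < b)
    (hb : b ≤ Λ) :
    ((Finset.univ.filter (fun k ↦ a < latt p m k ∧ latt p m k ≤ b)).card : ℤ) = ⌊b / p⌋ - ⌊a / p⌋ := by
  let e : Fin (2 * m + 1) ↪ ℤ := ⟨fun k ↦ ((k : ℕ) : ℤ) - m, fun k₁ k₂ h ↦ by
    apply Fin.ext
    have h' : ((k₁ : ℕ) : ℤ) - m = ((k₂ : ℕ) : ℤ) - m := h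
    omega⟩
  have himage : (Finset.univ.filter (fun k ↦ a < latt p m k ∧ latt p m k ≤ b)).map e
      = Finset.Ioc ⌊a / p⌋ ⌊b / p⌋ := by
    ext j
    simp only [Finset.mem_map, Finset.mem_filter, Finset.mem_univ, true_and, Finset.mem_Ioc, latt,
      Function.Embedding.coeFn_mk, e]
    constructor
    · rintro ⟨k, ⟨hk1, hk2⟩, rfl⟩
      push_cast at hk1 hk2 ⊢
      refine ⟨?_, ?_⟩
      · rw [Int.floor_lt]
        push_cast
        rw [div_lt_iff₀ hp]
        linarith
      · rw [Int.le_floor]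
        push_cast
        rw [le_div_iff₀ hp]
        linarith
    · rintro ⟨hj1, hj2⟩
      rw [Int.floor_lt] at hj1
      rw [Int.le_floor] at hj2
      have hbp : b / p ≤ Λ / p := div_le_div_of_nonneg_right hb hp.le
      have hap : -Λ / p ≤ a / p := div_le_div_of_nonneg_right ha hp.le
      have hneg : -Λ / p = -(Λ / p) := by ring
      have hj3 : (j : ℝ) < (m : ℝ) + 1 := by linarith
      have hj4 : -((m : ℝ) + 1) < (j : ℝ) := by linarith
      have hj3' : j < (m : ℤ) + 1 := by exact_mod_cast hj3
      have hj4' : -((m : ℤ) + 1) < j := by exact_mod_cast hj4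
      refine ⟨⟨(j + m).toNat, by omega⟩, ?_, ?_⟩
      · have hval : ((((j + (m : ℤ)).toNat : ℕ) : ℤ) - (m : ℤ) : ℤ) = j := by omega
        rw [hval]
        refine ⟨?_, ?_⟩
        · rw [div_lt_iff₀ hp] at hj1
          linarith
        · rw [le_div_iff₀ hp] at hj2
          linarith
      · show (((j + (m : ℤ)).toNat : ℕ) : ℤ) - (m : ℤ) = j
        omega
  rw [← Finset.card_map e, himage]
  exact Int.card_Ioc_of_le _ _ (Int.floor_mono (by
    exact div_le_div_of_nonneg_right hab.le hp.le))

/-- The synthesis function with `κ ≡ 0` helpers: `F(u) = 2 sinh(κ₀u) − Σ_k b_k e^{−iλ_k u}`. (G14) -/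
def synth {n : ℕ} (κ₀ : ℝ) (lam : Fin n → ℝ) (b : Fin n → ℂ) (u : ℝ) : ℂ :=
  2 * (Real.sinh (κ₀ * u) : ℂ) - ∑ k, b k * cexp (-(I * (lam k : ℂ) * u))

/-- Its trigonometric part: `re F(u) = 2 sinh(κ₀u) − trig(u)`. (G14) -/
def trig {n : ℕ} (lam : Fin n → ℝ) (b : Fin n → ℂ) (u : ℝ) : ℝ :=
  ∑ k, ((b k).re * Real.cos (lam k * u) + (b k).im * Real.sin (lam k * u))

/-- The synthesis `synth κ₀ lam b` is continuous. PURE. -/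
theorem continuous_synth {n : ℕ} (κ₀ : ℝ) (lam : Fin n → ℝ) (b : Fin n → ℂ) : Continuous (synth κ₀ lam b) := by
  unfold synth; fun_prop

/-- The trigonometric sum `trig lam b` is continuous. PURE. -/
theorem continuous_trig {n : ℕ} (lam : Fin n → ℝ) (b : Fin n → ℂ) : Continuous (trig lam b) := by
  unfold trig; fun_prop

/-- (G14) -/
theorem re_synth {n : ℕ} (κ₀ : ℝ) (lam : Fin n → ℝ) (b : Fin n → ℂ) (u : ℝ) :
    (synth κ₀ lam b u).re = 2 * Real.sinh (κ₀ * u) - trig lam b u := by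
  have hexp : ∀ k, cexp (-(I * (lam k : ℂ) * u)) = (Real.cos (lam k * u) : ℂ) - (Real.sin (lam k * u) : ℂ) * I := by
    intro k
    have : -(I * (lam k : ℂ) * u) = ((-(lam k * u) : ℝ) : ℂ) * I := by push_cast; ring
    rw [this, Complex.exp_mul_I, ← Complex.ofReal_cos, ← Complex.ofReal_sin, Real.cos_neg, Real.sin_neg]
    push_cast; ring
  unfold synth trig
  rw [Complex.sub_re, Complex.re_sum]
  congr 1
  · have h2 : (2 : ℂ) * (Real.sinh (κ₀ * u) : ℂ) = ((2 * Real.sinh (κ₀ * u) : ℝ) : ℂ) := by push_cast; ring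
    rw [h2, Complex.ofReal_re]
  · refine Finset.sum_congr rfl fun k _ ↦ ?_
    rw [hexp k]
    simp only [Complex.mul_re, Complex.mul_im, Complex.sub_re, Complex.sub_im, Complex.ofReal_re, Complex.ofReal_im,
      Complex.I_re, Complex.I_im]
    ring

/-- The GAIN `∫_{−1}^{1−L} 2(sinh κ₀(v+L) − sinh κ₀v) dv` of the test against `𝟙_{[L−1,1]} − 𝟙_{[−1,1−L]}`. (G14) -/
def gain (κ₀ L : ℝ) : ℝ := ∫ v in (-1 : ℝ)..(1 - L), 2 * (Real.sinh (κ₀ * (v + L)) - Real.sinh (κ₀ * v))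

/-- NEW (G15): the linear lower bound `gain ≥ 2κ₀L(2 − L)` (`sinh x − x` is monotone). -/
theorem gain_ge {κ₀ L : ℝ} (hκ : 0 ≤ κ₀) (hL0 : 0 ≤ L) (hL2 : L ≤ 2) : 2 * κ₀ * L * (2 - L) ≤ gain κ₀ L := by
  unfold gain
  have hmono : Monotone fun x ↦ Real.sinh x - x := Real.sinh_sub_id_strictMono.monotone
  have hpt : ∀ v : ℝ, 2 * (κ₀ * L) ≤ 2 * (Real.sinh (κ₀ * (v + L)) - Real.sinh (κ₀ * v)) := by
    intro v
    have h := hmono (show κ₀ * v ≤ κ₀ * (v + L) by nlinarith)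
    simp only at h
    nlinarith
  have h := intervalIntegral.integral_mono_on (μ := volume) (by linarith : (-1 : ℝ) ≤ 1 - L) intervalIntegrable_const
    ((by fun_prop : Continuous fun v : ℝ ↦ 2 * (Real.sinh (κ₀ * (v + L)) - Real.sinh (κ₀ * v))).intervalIntegrable _ _)
    (fun v _ ↦ hpt v)
  rw [intervalIntegral.integral_const, smul_eq_mul] at h
  have e : (1 - L - (-1)) * (2 * (κ₀ * L)) = 2 * κ₀ * L * (2 - L) := by ring
  linarith


/-- `∑ (if P i then M else 0) = M · #{i | P i}` over `Fin N`. PURE. -/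
theorem sum_ite_const_eq {N : ℕ} (P : Fin N → Prop) [DecidablePred P] (M : ℝ) :
    (∑ i : Fin N, if P i then M else 0) = M * ((Finset.univ.filter P).card : ℝ) := by
  rw [Finset.sum_ite, Finset.sum_const_zero, add_zero, Finset.sum_const, nsmul_eq_mul, mul_comm]

/-- VISIBILITY of a frequency `ξ` through the strip test: `mvis L ξ = 2∫_{L−1}^{1} sin(ξu) du` (planets `ξL ∈ 2πℤ` have `mvis = 0`). -/
def mvis (L ξ : ℝ) : ℝ := 2 * ∫ u in (L - 1)..1, Real.sin (ξ * u)

/-- Translation by `L` minus identity on `[−1, 1−L]` kills the cosines and doubles the sines: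
`∫_{−1}^{1−L} (trig(v+L) − trig v) dv = Σ_k im(b_k)·mvis L λ_k`. -/
theorem integral_trig_shift_sub {n : ℕ} (lam : Fin n → ℝ) (b : Fin n → ℂ) (L : ℝ) :
    ∫ v in (-1 : ℝ)..(1 - L), (trig lam b (v + L) - trig lam b v) = ∑ k, (b k).im * mvis L (lam k) := by
  have hcos : ∀ k, ∫ v in (-1 : ℝ)..(1 - L), Real.cos (lam k * (v + L)) = ∫ u in (L - 1)..1, Real.cos (lam k * u) := by
    intro k
    have h := intervalIntegral.integral_comp_add_right (fun u ↦ Real.cos (lam k * u)) L (a := -1) (b := 1 - L)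
    rw [show (-1 : ℝ) + L = L - 1 by ring, show (1 : ℝ) - L + L = 1 by ring] at h
    exact h
  have hcos' : ∀ k, ∫ v in (-1 : ℝ)..(1 - L), Real.cos (lam k * v) = ∫ u in (L - 1)..1, Real.cos (lam k * u) := by
    intro k
    have h := intervalIntegral.integral_comp_neg (fun u ↦ Real.cos (lam k * u)) (a := -1) (b := 1 - L)
    simp only [mul_neg, Real.cos_neg, neg_sub, neg_neg] at h
    exact h
  have hsin : ∀ k, ∫ v in (-1 : ℝ)..(1 - L), Real.sin (lam k * (v + L)) = ∫ u in (L - 1)..1, Real.sin (lam k * u) := by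
    intro k
    have h := intervalIntegral.integral_comp_add_right (fun u ↦ Real.sin (lam k * u)) L (a := -1) (b := 1 - L)
    rw [show (-1 : ℝ) + L = L - 1 by ring, show (1 : ℝ) - L + L = 1 by ring] at h
    exact h
  have hsin' : ∀ k, ∫ v in (-1 : ℝ)..(1 - L), Real.sin (lam k * v) = -∫ u in (L - 1)..1, Real.sin (lam k * u) := by
    intro k
    have h := intervalIntegral.integral_comp_neg (fun u ↦ Real.sin (lam k * u)) (a := -1) (b := 1 - L)
    simp only [mul_neg, Real.sin_neg, neg_sub, neg_neg, intervalIntegral.integral_neg] at h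
    linarith
  have hk : ∀ k, ∫ v in (-1 : ℝ)..(1 - L),
      (((b k).re * Real.cos (lam k * (v + L)) + (b k).im * Real.sin (lam k * (v + L)))
        - ((b k).re * Real.cos (lam k * v) + (b k).im * Real.sin (lam k * v))) = (b k).im * mvis L (lam k) := by
    intro k
    have e1 : (fun v : ℝ ↦ (((b k).re * Real.cos (lam k * (v + L)) + (b k).im * Real.sin (lam k * (v + L)))
        - ((b k).re * Real.cos (lam k * v) + (b k).im * Real.sin (lam k * v))))
        = fun v ↦ (b k).re * (Real.cos (lam k * (v + L)) - Real.cos (lam k * v))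
          + (b k).im * (Real.sin (lam k * (v + L)) - Real.sin (lam k * v)) := by
      funext v; ring
    have I1 : IntervalIntegrable (fun v ↦ (b k).re * (Real.cos (lam k * (v + L)) - Real.cos (lam k * v))) volume (-1) (1 - L) :=
      (by fun_prop : Continuous fun v ↦ (b k).re * (Real.cos (lam k * (v + L)) - Real.cos (lam k * v))).intervalIntegrable _ _
    have I2 : IntervalIntegrable (fun v ↦ (b k).im * (Real.sin (lam k * (v + L)) - Real.sin (lam k * v))) volume (-1) (1 - L) :=
      (by fun_prop : Continuous fun v ↦ (b k).im * (Real.sin (lam k * (v + L)) - Real.sin (lam k * v))).intervalIntegrable _ _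
    have I3 : IntervalIntegrable (fun v ↦ Real.cos (lam k * (v + L))) volume (-1) (1 - L) :=
      (by fun_prop : Continuous fun v ↦ Real.cos (lam k * (v + L))).intervalIntegrable _ _
    have I4 : IntervalIntegrable (fun v ↦ Real.cos (lam k * v)) volume (-1) (1 - L) :=
      (by fun_prop : Continuous fun v ↦ Real.cos (lam k * v)).intervalIntegrable _ _
    have I5 : IntervalIntegrable (fun v ↦ Real.sin (lam k * (v + L))) volume (-1) (1 - L) :=
      (by fun_prop : Continuous fun v ↦ Real.sin (lam k * (v + L))).intervalIntegrable _ _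
    have I6 : IntervalIntegrable (fun v ↦ Real.sin (lam k * v)) volume (-1) (1 - L) :=
      (by fun_prop : Continuous fun v ↦ Real.sin (lam k * v)).intervalIntegrable _ _
    rw [e1, intervalIntegral.integral_add I1 I2, intervalIntegral.integral_const_mul, intervalIntegral.integral_const_mul,
      intervalIntegral.integral_sub I3 I4, intervalIntegral.integral_sub I5 I6, hcos k, hcos' k, hsin k, hsin' k]
    unfold mvis
    ring
  have e : (fun v ↦ trig lam b (v + L) - trig lam b v) = fun v ↦ ∑ k,
      ((((b k).re * Real.cos (lam k * (v + L)) + (b k).im * Real.sin (lam k * (v + L)))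
        - ((b k).re * Real.cos (lam k * v) + (b k).im * Real.sin (lam k * v)))) := by
    funext v
    unfold trig
    rw [← Finset.sum_sub_distrib]
  rw [e, intervalIntegral.integral_finsetSum (fun k _ ↦ (by fun_prop : Continuous fun v ↦
      (((b k).re * Real.cos (lam k * (v + L)) + (b k).im * Real.sin (lam k * (v + L)))
        - ((b k).re * Real.cos (lam k * v) + (b k).im * Real.sin (lam k * v)))).intervalIntegrable _ _)]
  exact Finset.sum_congr rfl fun k _ ↦ hk k

/-- **THE CERTIFICATE.**  For EVERY finite configuration (`κ ≡ 0` helpers), every `1 ≤ L < 2`, all amplitudes `b` and every real `t`: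
`2t·gain(κ₀,L) − t²·(2(2−L) + Σ_k w_k·mvis(L,λ_k)²) ≤ ∫_{−1}^{1} ‖2 sinh(κ₀u) − Σ_k b_k e^{−iλ_k u}‖² du + Σ_k ‖b_k‖²/w_k`.
Proof: `‖F‖² ≥ ±2t·re F − t²` on the two end strips, translate the right strip by `L`; the cosines cancel, the sines leave
`Σ_k im(b_k)·mvis_k`, which is absorbed termwise into the ridge by `2t·im(b)·m ≤ ‖b‖²/w + t²·w·m²`. -/
theorem certificate {n : ℕ} {κ₀ L : ℝ} {lam w : Fin n → ℝ} (hw : ∀ k, 0 < w k) (hL1 : 1 ≤ L) (hL2 : L < 2)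
    (b : Fin n → ℂ) (t : ℝ) :
    2 * t * gain κ₀ L - t ^ 2 * (2 * (2 - L) + ∑ k, w k * mvis L (lam k) ^ 2)
      ≤ (∫ u in (-1 : ℝ)..1, ‖synth κ₀ lam b u‖ ^ 2) + ∑ k, ‖b k‖ ^ 2 / w k := by
  set F := synth κ₀ lam b with hFdef
  have hF : Continuous F := continuous_synth κ₀ lam b
  have hG : Continuous fun u ↦ ‖F u‖ ^ 2 := by fun_prop
  have hre : Continuous fun u ↦ (F u).re := by fun_prop
  have iG : ∀ x y : ℝ, IntervalIntegrable (fun u ↦ ‖F u‖ ^ 2) volume x y := fun x y ↦ hG.intervalIntegrable x y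
  have hct : Continuous (trig lam b) := continuous_trig lam b
  have hctL : Continuous fun v ↦ trig lam b (v + L) := hct.comp (continuous_id.add continuous_const)
  -- split `[-1, 1] = [-1, 1-L] ∪ [1-L, L-1] ∪ [L-1, 1]`
  have hsplit : ∫ u in (-1 : ℝ)..1, ‖F u‖ ^ 2
      = (∫ u in (-1 : ℝ)..(1 - L), ‖F u‖ ^ 2) + ((∫ u in (1 - L)..(L - 1), ‖F u‖ ^ 2) + ∫ u in (L - 1)..1, ‖F u‖ ^ 2) := by
    rw [intervalIntegral.integral_add_adjacent_intervals (iG _ _) (iG _ _),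
      intervalIntegral.integral_add_adjacent_intervals (iG _ _) (iG _ _)]
  have hmid : 0 ≤ ∫ u in (1 - L)..(L - 1), ‖F u‖ ^ 2 :=
    intervalIntegral.integral_nonneg (by linarith) fun u _ ↦ by positivity
  have hpiece : ∀ (s x y : ℝ), x ≤ y →
      2 * s * (∫ u in x..y, (F u).re) - s ^ 2 * (y - x) ≤ ∫ u in x..y, ‖F u‖ ^ 2 := by
    intro s x y hxy
    have hmono := intervalIntegral.integral_mono_on hxy
      ((by fun_prop : Continuous fun u ↦ 2 * s * (F u).re - s ^ 2).intervalIntegrable _ _) (iG x y)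
      (fun u _ ↦ two_mul_re_sub_sq_le (F u) s)
    have hcalc : ∫ u in x..y, (2 * s * (F u).re - s ^ 2) = 2 * s * (∫ u in x..y, (F u).re) - s ^ 2 * (y - x) := by
      rw [intervalIntegral.integral_sub ((by fun_prop : Continuous fun u ↦ 2 * s * (F u).re).intervalIntegrable _ _)
        intervalIntegrable_const, intervalIntegral.integral_const_mul, intervalIntegral.integral_const, smul_eq_mul]
      ring
    linarith
  have hright := hpiece t (L - 1) 1 (by linarith)
  have hleft := hpiece (-t) (-1) (1 - L) (by linarith)
  -- translation of the right piece
  have htrans : ∫ u in (L - 1)..1, (F u).re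
      = ∫ v in (-1 : ℝ)..(1 - L), (2 * Real.sinh (κ₀ * (v + L)) - trig lam b (v + L)) := by
    have h1 : ∫ v in (-1 : ℝ)..(1 - L), (F (v + L)).re = ∫ u in (-1 + L)..(1 - L + L), (F u).re :=
      intervalIntegral.integral_comp_add_right (fun u ↦ (F u).re) L
    have h2 : (-1 : ℝ) + L = L - 1 := by ring
    have h3 : (1 : ℝ) - L + L = 1 := by ring
    rw [h2, h3] at h1
    rw [← h1]
    refine intervalIntegral.integral_congr fun v _ ↦ ?_
    simp only [hFdef]
    rw [re_synth]
  have hleftre : ∫ u in (-1 : ℝ)..(1 - L), (F u).re = ∫ v in (-1 : ℝ)..(1 - L), (2 * Real.sinh (κ₀ * v) - trig lam b v) := by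
    refine intervalIntegral.integral_congr fun v _ ↦ ?_
    simp only [hFdef]
    rw [re_synth]
  have J1 : IntervalIntegrable (fun v ↦ 2 * Real.sinh (κ₀ * (v + L)) - trig lam b (v + L)) volume (-1) (1 - L) :=
    ((by fun_prop : Continuous fun v : ℝ ↦ 2 * Real.sinh (κ₀ * (v + L))).sub hctL).intervalIntegrable _ _
  have J2 : IntervalIntegrable (fun v ↦ 2 * Real.sinh (κ₀ * v) - trig lam b v) volume (-1) (1 - L) :=
    ((by fun_prop : Continuous fun v : ℝ ↦ 2 * Real.sinh (κ₀ * v)).sub hct).intervalIntegrable _ _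
  have J3 : IntervalIntegrable (fun v ↦ 2 * (Real.sinh (κ₀ * (v + L)) - Real.sinh (κ₀ * v))) volume (-1) (1 - L) :=
    (by fun_prop : Continuous fun v : ℝ ↦ 2 * (Real.sinh (κ₀ * (v + L)) - Real.sinh (κ₀ * v))).intervalIntegrable _ _
  have J4 : IntervalIntegrable (fun v ↦ trig lam b (v + L) - trig lam b v) volume (-1) (1 - L) :=
    (hctL.sub hct).intervalIntegrable _ _
  have hdiff : (∫ u in (L - 1)..1, (F u).re) - ∫ u in (-1 : ℝ)..(1 - L), (F u).re
      = gain κ₀ L - ∑ k, (b k).im * mvis L (lam k) := by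
    rw [htrans, hleftre, ← intervalIntegral.integral_sub J1 J2, ← integral_trig_shift_sub lam b L]
    unfold gain
    rw [← intervalIntegral.integral_sub J3 J4]
    refine intervalIntegral.integral_congr fun v _ ↦ ?_
    ring
  -- AM-GM absorption of the moon terms into the ridge
  have hamgm : ∀ k, 2 * t * ((b k).im * mvis L (lam k)) ≤ ‖b k‖ ^ 2 / w k + t ^ 2 * (w k * mvis L (lam k) ^ 2) := by
    intro k
    have hw' := hw k
    have him : |(b k).im| ≤ ‖b k‖ := Complex.abs_im_le_norm _
    have him2 : (b k).im ^ 2 ≤ ‖b k‖ ^ 2 := by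
      rw [← sq_abs (b k).im]
      exact pow_le_pow_left₀ (abs_nonneg _) him 2
    rw [div_add' _ _ _ hw'.ne', le_div_iff₀ hw']
    nlinarith [sq_nonneg ((b k).im - t * w k * mvis L (lam k)), hw'.le]
  have hsum : 2 * t * ∑ k, (b k).im * mvis L (lam k) ≤ (∑ k, ‖b k‖ ^ 2 / w k) + t ^ 2 * ∑ k, w k * mvis L (lam k) ^ 2 := by
    rw [Finset.mul_sum, Finset.mul_sum, ← Finset.sum_add_distrib]
    exact Finset.sum_le_sum fun k _ ↦ hamgm k
  have key : 2 * t * (gain κ₀ L - ∑ k, (b k).im * mvis L (lam k)) - t ^ 2 * (2 * (2 - L))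
      ≤ ∫ u in (-1 : ℝ)..1, ‖F u‖ ^ 2 := by
    rw [hsplit, ← hdiff]
    have e : (-t) ^ 2 = t ^ 2 := by ring
    rw [e] at hleft
    linarith [hright, hleft, hmid]
  linarith [key, hsum]


end Summit.RiemannHypothesis.RiemannHypothesis.Theorems.Splittings.MassAwareSamplingCeiling
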